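import Literature.Computability.QuantumComplexity.BQP
import Literature.Computability.Cryptography.QubitRegisterProofs
import Literature.Computability.Cryptography.QubitRegisterHGateProofs
import Literature.Computability.Cryptography.QubitRegisterTGateProofs
import Literature.Computability.Cryptography.QubitRegisterCnotProofs
import Mathlib.Topology.Algebra.Group.Basic
import HarnessLib

/-!
# Universality of `{H, T, CNOT}`: the two printed ingredients and the assembly

Towards the discharge of the named fact
`Literature.Computability.QuantumComplexity.hTCnot_generatesDenselyModPhase` of
`Literature.Computability.QuantumComplexity.BQP` (**quantum-advantage.S08**, literal form): for
every `n ≥ 1` the placements of the gates `H`, `T = σ_z^{1/4}`, `CNOT` on `n` wires, together with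
the global phases, generate a dense subgroup of `U(2^n)`.

The printed proof (Boykin–Mor–Pulver–Roychowdhury–Vatan, FOCS 1999, §3 "A proof of
universality") has exactly two steps, which this file records as two named facts and then
assembles (the assembly is proved here):

* **Step 1** (`boykin1999_HT_generatesDenselyModPhase`, Boykin et al. §3, first step): `H` and
  `σ_z^{1/4}` generate a dense subgroup of `U(2)` modulo phase — the words
  `σ_z^{-1/4} σ_x^{1/4}` and `H^{-1/2} σ_z^{-1/4} σ_x^{1/4} H^{1/2}` are rotations by the angle
  `2πλ`, `cos λπ = cos²(π/8)`, about two *orthogonal* axes, `λ` is irrational because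
  `e^{2πiλ}` is a root of the non-integral monic irreducible `x⁴ + x³ + x²/4 + x + 1`
  (App., Thm. 7.1), so the two cyclic groups are dense in two one-parameter subgroups, and the
  Euler decomposition about two orthogonal axes (eqs. (euler), (cos), (sn)) covers `SU(2)`.
* **Step 2** (`barenco1995_exactUniversality`, Barenco et al. 1995, abstract and §8, which
  Boykin et al. cite as "[egfqc]": "for universal quantum computation all that is needed is
  `Λ₁(σ_x)` and `SU(2)`"): every element of `U(2^n)`, `n ≥ 1`, is a finite product of one-qubit
  gates and `CNOT`s placed on the `n` wires (two-level decomposition of Reck et al., Gray codes,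
  and the `Λ_{n-1}(U)` networks of Lemmas 4.3, 5.1, 7.5 and Cor. 7.6).
* **Assembly** (`hTCnot_generatesDenselyModPhase_of`, proved): the closure `K` of the group
  generated by the `{H, T, CNOT}`-placements and the phases is a closed subgroup of `U(2^n)`;
  pulling it back along the continuous homomorphism `U ↦ placeGate e U` (`placeGateHom e`,
  one for each wire `e : Fin 1 ↪ Fin n`) gives a closed subgroup of `U(2)` containing `H`, `T`
  and the phases, hence all of `U(2)` by Step 1; so `K` contains every one-qubit placement and
  every `CNOT` placement, hence `K = U(2^n)` by Step 2.

Also: `placeGateHom` (placement as a monoid homomorphism of unitary groups), its continuity,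
`placeGate_smul` (placement is linear, so phases are placed to phases), and the generator set
`oneQubitCnotGenerators n` of Step 2.

## References

* P. O. Boykin, T. Mor, M. Pulver, V. Roychowdhury, F. Vatan, *On universal and fault-tolerant
  quantum computing: a novel basis and a new constructive proof of universality for Shor's
  basis*, FOCS 1999, 486–494; arXiv:quant-ph/9906054, §3 and App. (Thm. 7.1).
  [Boykin1999FOCS] (= the interim key [BoykinMorPulverRoychowdhuryVatan1999])
* A. Barenco, C. H. Bennett, R. Cleve, D. P. DiVincenzo, N. Margolus, P. Shor, T. Sleator,
  J. A. Smolin, H. Weinfurter, *Elementary gates for quantum computation*, Phys. Rev. A 52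
  (1995) 3457–3467; arXiv:quant-ph/9503016, abstract, §8 (last part: exact simulation of any
  unitary operator on `n` bits from two-level matrices and Gray codes), Lemmas 4.1, 4.3, 5.1,
  7.5, Cor. 7.6. [BarencoEtAl1995]
* M. A. Nielsen, I. L. Chuang, *Quantum Computation and Quantum Information*, CUP 2010,
  §4.5.1–4.5.3 (textbook account of both steps). [NielsenChuang2010]

## Design notes

* Step 1 is stated for the two matrices `hGate`, `tGate` on `QReg 1` with the library's
  `GeneratesDenselyModPhase` (density of the generated subgroup of `U(2)` *together with the
  phases*): the paper's "`H` and `σ_z^{1/4}` form a dense set in `SU(2)`" is meant modulo phase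
  (`det H = -1`, `det σ_z^{1/4} = e^{iπ/4}`, neither lies in `SU(2)`).
* Step 2 is stated as `Subgroup.closure (oneQubitCnotGenerators n) = ⊤` in
  `Matrix.unitaryGroup (QReg n) ℂ` for `n ≥ 1` (for `n = 0` there are no wires to place a gate on
  and `U(1)` is not trivial).
* Nothing here is specific to the error model or to circuits; the facts are about matrix groups.
-/

noncomputable section

namespace Literature.Computability.QuantumComplexity

open _root_.Computability Cryptography Matrix _root_.Topology

/-! ### Placement as a continuous homomorphism of unitary groups -/

section placeGateHom

variable {k n : ℕ}

/-- Placement is linear in the gate: `placeGate e (c • U) = c • placeGate e U`.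
(Nielsen–Chuang 2010, §4.3: a gate on a subset of the wires is `U ⊗ I`, bilinear.) [folklore] -/
theorem placeGate_smul (e : Fin k ↪ Fin n) (c : ℂ) (U : Matrix (QReg k) (QReg k) ℂ) :
    placeGate e (c • U) = c • placeGate e U := by
  ext x y
  simp only [placeGate_apply, Matrix.smul_apply, smul_eq_mul]
  split_ifs <;> simp

/-- A global phase placed on some wires is the same global phase:
`placeGate e (c • 1) = c • 1`. [folklore] -/
theorem placeGate_smul_one (e : Fin k ↪ Fin n) (c : ℂ) :
    placeGate e (c • (1 : Matrix (QReg k) (QReg k) ℂ)) = c • (1 : Matrix (QReg n) (QReg n) ℂ) := by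
  rw [placeGate_smul, placeGate_one]

/-- **Placement as a group homomorphism** `U(2^k) → U(2^n)`, `U ↦ placeGate e U` (`U ⊗ I` up to
the ordering of the tensor factors): multiplicative by `placeGate_mul`, unitary by
`placeGate_mem_unitaryGroup`. (Nielsen–Chuang 2010, §4.2–4.3.) [folklore] -/
def placeGateHom (e : Fin k ↪ Fin n) :
    Matrix.unitaryGroup (QReg k) ℂ →* Matrix.unitaryGroup (QReg n) ℂ where
  toFun U := ⟨placeGate e U.1, placeGate_mem_unitaryGroup_holds e U.2⟩
  map_one' := Subtype.ext (by simp)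
  map_mul' U V := Subtype.ext (by
    simp only [Submonoid.coe_mul]
    exact placeGate_mul_holds e U.1 V.1)

/-- The underlying matrix of `placeGateHom e U` is `placeGate e U`. [folklore] -/
@[simp] theorem coe_placeGateHom (e : Fin k ↪ Fin n) (U : Matrix.unitaryGroup (QReg k) ℂ) :
    ((placeGateHom e U : Matrix.unitaryGroup (QReg n) ℂ) : Matrix (QReg n) (QReg n) ℂ) =
      placeGate e U.1 := rfl

/-- `U ↦ placeGate e U` is continuous (each entry is an entry of `U` or `0`). [folklore] -/
theorem continuous_placeGate (e : Fin k ↪ Fin n) :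
    Continuous fun U : Matrix (QReg k) (QReg k) ℂ => placeGate e U := by
  refine continuous_pi fun x => continuous_pi fun y => ?_
  by_cases h : ∀ i, i ∉ Set.range e → x i = y i
  · simp only [placeGate_apply, if_pos h]
    exact (continuous_apply (y ∘ e)).comp (continuous_apply (x ∘ e))
  · simp only [placeGate_apply, if_neg h]
    exact continuous_const

/-- The placement homomorphism `placeGateHom e : U(2^k) → U(2^n)` is continuous. [folklore] -/
theorem continuous_placeGateHom (e : Fin k ↪ Fin n) : Continuous (placeGateHom e) :=
  Continuous.subtype_mk ((continuous_placeGate e).comp continuous_subtype_val) _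

end placeGateHom

/-! ### The two printed ingredients as named facts -/

/-- The generators of Barenco et al.: all placements on `n` wires of arbitrary one-qubit
unitaries `V ∈ U(2)` and of the `CNOT` gate, as a subset of `U(2^n)`.
(Barenco et al. 1995, abstract and §2: "all one-bit quantum gates (U(2)) and the two-bit
exclusive-or gate".) [cite: BarencoEtAl1995, abstract and §2] -/
def oneQubitCnotGenerators (n : ℕ) : Set (Matrix.unitaryGroup (QReg n) ℂ) :=
  {U | (∃ (e : Fin 1 ↪ Fin n) (V : Matrix.unitaryGroup (QReg 1) ℂ), U.1 = placeGate e V.1) ∨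
    ∃ e : Fin 2 ↪ Fin n, U.1 = placeGate e cnot}

/-- **Exact universality of one-qubit gates and `CNOT`** (Barenco–Bennett–Cleve–DiVincenzo–
Margolus–Shor–Sleator–Smolin–Weinfurter 1995, abstract: "a set of gates that consists of all
one-bit quantum gates (U(2)) and the two-bit exclusive-or gate … is universal in the sense that
all unitary operations on arbitrarily many bits `n` (U(2ⁿ)) can be expressed as compositions of
these gates"; proof: §8, last part — two-level decomposition `U = (∏ T(x1,x2)) · D` of Reck et
al., each two-level factor realised through a Gray code by the `Λ_{n-1}(U)` networks of
Lemma 7.5/Cor. 7.6, which rest on Lemmas 4.1, 4.3, 5.1; textbook form: Nielsen–Chuang 2010,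
§4.5.1–4.5.2). For every `n ≥ 1`, the subgroup of `U(2^n)` generated by the placements of
one-qubit unitaries and of `CNOT` is all of `U(2^n)`. This is the step "[egfqc]" of the
universality proof of Boykin et al. 1999, §3. [cite: BarencoEtAl1995, abstract and §8] -/
def barenco1995_exactUniversality : Prop :=
  ∀ n, 1 ≤ n → Subgroup.closure (oneQubitCnotGenerators n) = ⊤

/-- **`H` and `T = σ_z^{1/4}` are dense in `U(2)` modulo phase** (Boykin–Mor–Pulver–
Roychowdhury–Vatan 1999, §3, first step: "`H` and `σ_z^{1/4}` form a dense set in `SU(2)`",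
meant modulo global phase since `det H = -1`, `det σ_z^{1/4} = e^{iπ/4}`). The subgroup of
`U(2) = U(QReg 1)` generated by `hGate`, `tGate` and the phases `c • 1` is dense. Printed proof:
`σ_z^{-1/4}σ_x^{1/4}` and its conjugate by `H^{1/2} = σ_y^{1/4} σ_z^{1/2} σ_y^{-1/4}` (a word in
`H`, `T`) are rotations by `2πλ`, `cos λπ = cos²(π/8)`, about two orthogonal axes (eq. (axes));
`λ ∉ ℚ` since `e^{2πiλ}` is a root of the non-integral monic irreducible `x⁴+x³+x²/4+x+1`
(App., Thm. 7.1); hence both one-parameter subgroups lie in the closure, and the Euler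
decomposition about orthogonal axes (eqs. (euler), (cos), (sn)) gives `SU(2)`; the phases give
`U(2)`. (Textbook: Nielsen–Chuang 2010, §4.5.3.) [cite: Boykin1999FOCS, §3 (first step) and App. Thm. 7.1] -/
def boykin1999_HT_generatesDenselyModPhase : Prop :=
  GeneratesDenselyModPhase 1 ({hGate, tGate} : Set (Matrix (QReg 1) (QReg 1) ℂ))

/-! ### Assembly -/

/-- `S ≠ H`, `S ≠ T`, `S ≠ CNOT` bookkeeping: the three gates of `hTCnotPlacements`. [folklore] -/
theorem placeGate_mem_hTCnotPlacements {n : ℕ} (g : CliffordTOp) (hg : g ≠ CliffordTOp.S)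
    (e : Fin (cliffordT.arity g) ↪ Fin n) :
    placeGate e (cliffordT.mat g) ∈ hTCnotPlacements n :=
  ⟨g, e, hg, rfl⟩

/-- **Assembly of the universality proof of Boykin et al. (1999, §3).** Exact universality of
one-qubit gates + `CNOT` (Barenco et al. 1995) and density of `⟨H, T⟩` in `U(2)` modulo phase
(Boykin et al. 1999, §3, first step) imply that the placements of `{H, T, CNOT}` on `n ≥ 1`
wires generate `U(2^n)` densely modulo phase: the closure `K` of the generated group is a closed
subgroup; its preimage under the continuous homomorphism `placeGateHom e` (`e : Fin 1 ↪ Fin n`)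
is a closed subgroup of `U(2)` containing `H`, `T` and the phases, hence everything, so `K`
contains all one-qubit placements; it contains the `CNOT` placements by definition; hence
`K = U(2^n)`. [cite: Boykin1999FOCS, §3 (second step, "[egfqc]")] -/
theorem hTCnot_generatesDenselyModPhase_of (hB : barenco1995_exactUniversality)
    (hD : boykin1999_HT_generatesDenselyModPhase) : hTCnot_generatesDenselyModPhase := by
  intro n hn
  -- the generated group `Γ` and its closure `K`
  set Sn : Set (Matrix.unitaryGroup (QReg n) ℂ) :=
    {U | U.1 ∈ hTCnotPlacements n ∨ ∃ c : ℂ, U.1 = c • (1 : Matrix (QReg n) (QReg n) ℂ)} with hSn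
  set Γ : Subgroup (Matrix.unitaryGroup (QReg n) ℂ) := Subgroup.closure Sn with hΓ
  set K : Subgroup (Matrix.unitaryGroup (QReg n) ℂ) := Γ.topologicalClosure with hK
  have hKcoe : (K : Set (Matrix.unitaryGroup (QReg n) ℂ)) = closure (Γ : Set _) :=
    Subgroup.topologicalClosure_coe
  -- it suffices that `K = ⊤`
  suffices hTop : K = ⊤ by
    change Dense (Γ : Set (Matrix.unitaryGroup (QReg n) ℂ))
    rw [dense_iff_closure_eq, ← hKcoe, hTop, Subgroup.coe_top]
  have hΓK : Γ ≤ K := Subgroup.le_topologicalClosure Γ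
  -- (1) every one-qubit placement lies in `K`
  have h1 : ∀ (e : Fin 1 ↪ Fin n) (V : Matrix.unitaryGroup (QReg 1) ℂ), placeGateHom e V ∈ K := by
    intro e V
    set S1 : Set (Matrix.unitaryGroup (QReg 1) ℂ) :=
      {U | U.1 ∈ ({hGate, tGate} : Set (Matrix (QReg 1) (QReg 1) ℂ)) ∨
        ∃ c : ℂ, U.1 = c • (1 : Matrix (QReg 1) (QReg 1) ℂ)} with hS1
    -- `V` is in the closure of the dense subgroup generated by `H`, `T` and the phases
    have hV : V ∈ closure ((Subgroup.closure S1 : Subgroup (Matrix.unitaryGroup (QReg 1) ℂ)) :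
        Set (Matrix.unitaryGroup (QReg 1) ℂ)) := by
      have hdense : Dense ((Subgroup.closure S1 : Subgroup (Matrix.unitaryGroup (QReg 1) ℂ)) :
          Set (Matrix.unitaryGroup (QReg 1) ℂ)) := hD
      rw [hdense.closure_eq]
      exact Set.mem_univ V
    -- the image of that subgroup under `placeGateHom e` lies in `Γ`
    have hsub : (placeGateHom e) '' ((Subgroup.closure S1 : Subgroup (Matrix.unitaryGroup (QReg 1) ℂ)) :
        Set (Matrix.unitaryGroup (QReg 1) ℂ)) ⊆ (Γ : Set (Matrix.unitaryGroup (QReg n) ℂ)) := by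
      have hle : Subgroup.map (placeGateHom e) (Subgroup.closure S1) ≤ Γ := by
        rw [MonoidHom.map_closure, hΓ]
        refine (Subgroup.closure_le _).mpr ?_
        rintro _ ⟨W, hW, rfl⟩
        apply Subgroup.subset_closure
        rcases hW with hW | ⟨c, hc⟩
        · left
          rcases hW with hWH | hWT
          · rw [coe_placeGateHom, hWH]
            exact placeGate_mem_hTCnotPlacements CliffordTOp.H (by decide) e
          · rw [Set.mem_singleton_iff] at hWT
            rw [coe_placeGateHom, hWT]
            exact placeGate_mem_hTCnotPlacements CliffordTOp.T (by decide) e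
        · right
          exact ⟨c, by rw [coe_placeGateHom, hc, placeGate_smul_one]⟩
      rintro _ ⟨W, hW, rfl⟩
      exact hle ⟨W, hW, rfl⟩
    have hmem : placeGateHom e V ∈ closure ((placeGateHom e) ''
        ((Subgroup.closure S1 : Subgroup (Matrix.unitaryGroup (QReg 1) ℂ)) :
          Set (Matrix.unitaryGroup (QReg 1) ℂ))) :=
      image_closure_subset_closure_image (continuous_placeGateHom e) ⟨V, hV, rfl⟩
    have hmem' : placeGateHom e V ∈ (K : Set (Matrix.unitaryGroup (QReg n) ℂ)) := by
      rw [hKcoe]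
      exact closure_mono hsub hmem
    exact hmem'
  -- (2) every `CNOT` placement lies in `Γ ≤ K`
  have h2 : ∀ e : Fin 2 ↪ Fin n,
      (⟨placeGate e cnot, placeGate_mem_unitaryGroup_holds e cnot_mem_unitaryGroup_holds⟩ :
        Matrix.unitaryGroup (QReg n) ℂ) ∈ K := by
    intro e
    apply hΓK
    apply Subgroup.subset_closure
    left
    exact placeGate_mem_hTCnotPlacements CliffordTOp.CNOT (by decide) e
  -- (3) Barenco et al.: one-qubit placements and `CNOT`s generate everything
  rw [eq_top_iff, ← hB n hn]
  refine (Subgroup.closure_le _).mpr ?_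
  rintro U (⟨e, V, hU⟩ | ⟨e, hU⟩)
  · have hUeq : U = placeGateHom e V := Subtype.ext (by rw [coe_placeGateHom]; exact hU)
    rw [hUeq]
    exact h1 e V
  · have hUeq : U = ⟨placeGate e cnot,
        placeGate_mem_unitaryGroup_holds e cnot_mem_unitaryGroup_holds⟩ := Subtype.ext hU
    rw [hUeq]
    exact h2 e

end Literature.Computability.QuantumComplexity
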